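import Summits.Langlands.Langlands.Theses.PhantomRMYoshida
import Summits.Langlands.Langlands.Theses.BaseFieldAscent
import Summits.Langlands.Langlands.Theorems.PhantomRMYoshidaPhantomRMJunction

/-!
# Route PhantomRMYoshida — `PhantomRMJunction` (stmt-Langlands-13643): position in the obligation graph

`PhantomRMJunction := ∀ _ : PhantomRMSector, Langlands` is the route's FRAME item (the rest of the
summit given the sector; `Theorems/PhantomRMYoshidaPhantomRMJunction.lean` records its truth table:
under the route target it is literally `↔ Langlands`). This file makes its dependency on an EXISTING
item of the ledger kernel-checked, in `↔` form only (no theorem here concludes an item, the summit, or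
a negation of either under hypotheses, so that no audit credits a conditional arrow):

* `langlands_and_reciprocityTRCM_iff`: `BaseFieldAscent.ReciprocityTRCM` (stmt-Langlands-1093: the
  summit restricted to totally real or CM base fields) is a corollary of the summit;
* `phantomRMJunction_and_reciprocityTRCM_iff_of_target`: under the route target `PhantomRMSector`,
  the junction already contains `ReciprocityTRCM` — NECESSITY: the item cannot close before
  stmt-Langlands-1093 closes;
* `phantomRMJunction_iff_reciprocityTRCM_of_ascent`: under the route target and the two ascent
  cruxes of route BaseFieldAscent (`AscentConjugationSolvable`, stmt-Langlands-1094;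
  `AscentResidual`, stmt-Langlands-1095) the junction IS `ReciprocityTRCM` — SUFFICIENCY is that
  route's sorry-free `closes`.

So the frame item is sandwiched between items that are already on the ledger and staffed elsewhere:
`ReciprocityTRCM ∧ AscentConjugationSolvable ∧ AscentResidual → PhantomRMJunction` and
`PhantomRMJunction ∧ PhantomRMSector → ReciprocityTRCM`.

Mechanical repair 2026-08-17 (statement re-type D-0032 §4c, p141787: the summit is now
`∀ F, Nonempty (ReciprocityData F) ∧ ∀ 𝓡 n, 0 < n → ∀ hcpt, …`, while `ReciprocityTRCM` keeps its
`∃ R`-shape): the three proofs restrict the summit to a field by `Nonempty.elim` on the first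
conjunct and the `∀ 𝓡` clause at that datum; every statement of this file is unchanged and all
three remain theorems (new summit at `F` ⇒ old `∃ R` clause at `F`). D-0032 Q-L2 for this item:
the `←` of the sandwich is still `BaseFieldAscent.closes` by name, so the `∃ R → ∀ 𝓡` upgrade now
lives inside that route's ascent cruxes, not here.
-/

set_option linter.dupNamespace false -- project-wide option; `Summit.Langlands.Langlands` is the mandated namespace

namespace Summit.Langlands.Langlands.Theorems

open Summit.Langlands.Langlands.Theses
open Summit.Langlands.Langlands.Theses.PhantomRMYoshida

/-- `ReciprocityTRCM` (stmt-Langlands-1093) is the summit body restricted to totally real or CM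
base fields, hence a corollary of the summit: `Langlands ∧ ReciprocityTRCM ↔ Langlands`.
[folklore] -/
theorem langlands_and_reciprocityTRCM_iff :
    (_root_.Langlands ∧ BaseFieldAscent.ReciprocityTRCM) ↔ _root_.Langlands :=
  ⟨And.left, fun hL ↦ ⟨hL, fun F _ _ _ ↦ (hL F).1.elim fun R ↦ ⟨R, (hL F).2 R⟩⟩⟩

/-- NECESSITY. Under the route target `PhantomRMSector`, the junction already contains
`ReciprocityTRCM`: `PhantomRMJunction ∧ ReciprocityTRCM ↔ PhantomRMJunction` (the junction and the
target give `Langlands`, which restricts to totally real / CM base fields). In particular the item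
stmt-Langlands-13643 cannot close before stmt-Langlands-1093 does. [folklore] -/
theorem phantomRMJunction_and_reciprocityTRCM_iff_of_target (hX : PhantomRMSector) :
    (PhantomRMJunction ∧ BaseFieldAscent.ReciprocityTRCM) ↔ PhantomRMJunction :=
  ⟨And.left, fun hJ ↦ ⟨hJ, fun F _ _ _ ↦ (hJ hX F).1.elim fun R ↦ ⟨R, (hJ hX F).2 R⟩⟩⟩

/-- SANDWICH. Under the route target `PhantomRMSector` and the two ascent cruxes of
route-Langlands-BaseFieldAscent (`AscentConjugationSolvable`, stmt-Langlands-1094, and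
`AscentResidual`, stmt-Langlands-1095), the junction is EQUIVALENT to `ReciprocityTRCM`
(stmt-Langlands-1093): `→` is necessity as above, `←` is that route's sorry-free deciding theorem
`BaseFieldAscent.closes` followed by discarding the sector. [folklore] -/
theorem phantomRMJunction_iff_reciprocityTRCM_of_ascent
    (h₂ : BaseFieldAscent.AscentConjugationSolvable) (h₃ : BaseFieldAscent.AscentResidual)
    (hX : PhantomRMSector) :
    PhantomRMJunction ↔ BaseFieldAscent.ReciprocityTRCM :=
  ⟨fun hJ F _ _ _ ↦ (hJ hX F).1.elim fun R ↦ ⟨R, (hJ hX F).2 R⟩,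
    fun h₁ _ ↦ BaseFieldAscent.closes h₁ h₂ h₃⟩

end Summit.Langlands.Langlands.Theorems
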